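import Mathlib
import Literature.NumberTheory.Sieve.FriedlanderIwaniecPrimesThresholdSeparation
import Literature.NumberTheory.Sieve.FriedlanderIwaniecPrimesCutoffSeparation
import Summits.Parity.GeneralizedHardyLittlewood.Theorems.FordMaynardSieveConst01651SieveConst01651TypeIICoeffs

/-!
# Route `FordMaynardSieveConst01651`, target `SieveConst01651` (stmt-Parity-19185), line `sieve_decomposition`:
# helpers towards `stub_typeIIRegion` — Ford–Maynard Lemma 7.10 ("encoding a polytope condition") as a
# `BilinBoundedBy` transformer: threshold separation WITHOUT a gap hypothesis

Ford–Maynard (arXiv:2407.14368v1, §7.3) separate the variables of an inequality `f(n) > g(m)` inside a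
bilinear / multilinear sum in two ways: Lemma 7.9 (integer-valued `f`, `g`, so `|f - g| ≥ 1/2` — a GAP — and
truncated Perron costs only `log x`), and Lemma 7.10 (real-exponent monomial conditions
`n₁^{c₁}⋯n_k^{c_k} < 1` coming from POLYTOPES, where no gap is available: one smooths at scale `δ = x⁻²`,
separates the smoothed indicator by Mellin inversion at the cost `log(1/δ)`, and is left with the mass of the
summand on the thin SHELL `n₁^{c₁}⋯n_k^{c_k} ∈ [1-δ, 1+δ]`; that shell mass is where the second half of
hypothesis (w), `w_n ≥ -x^{ν/10}`, enters: `|w_n| ≤ w_n + 2x^{ν/10}`, the `w_n`-part is again a smoothed —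
hence separable — sum, and the rest is a lattice-point count).

The tree proves the GAP version as `BilinBoundedBy.threshold` (Friedlander–Iwaniec's trapezoid `H = trapz R² 1`
and its Fourier transform, `∫ ‖𝓕H‖ ≤ 3(1 + log R)`).  This file proves the NO-GAP version in the same
currency, i.e. Lemma 7.10 for bilinear forms with `1`-bounded coefficients:

* `bilin_trapz_twist` — twisting a kernel by ANY trapezoid `trapz L δ (c (A z - B w) + d)` of a difference
  of a function of `z` and a function of `w` keeps `BilinBoundedBy`, at the cost `∫ ‖𝓕(trapz L δ)‖`
  (no hypothesis on `A`, `B` at all); `bilin_trapz_twist_sq` — the case `H = trapz R² 1`, cost `3(1 + log R)`.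
* `bilin_threshold_shell` — `[B w < A z] · K` is `BilinBoundedBy` with bound
  `3(1 + log R) X + ∑_{(w,z) ∈ W × Z, |A z - B w| < 1/R} ‖K w z‖` as soon as `|A z - B w| ≤ R`
  (the first summand is the smoothed part, the second the shell = Ford–Maynard's `S₂`);
  `bilin_threshold_shell_le` — the same for the non-strict condition `[B w ≤ A z]`.
* `bilin_shell_abs_sum_le` — the shell mass of a REAL kernel `k ≥ -M` (`M ≥ 0`) on `W × Z`:
  `∑_{|A z - B w| ≤ 1/R} |k w z| ≤ 3 X + 2 ∑_{|A z - B w| ≤ 3/R} M w z` (Ford–Maynard's `S₂ ≤ S₃ + 2 S₄` with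
  `S₃` separated by a second trapezoid that majorises the shell indicator);
* `bilin_threshold_of_neg_le` — the two combined: for a real kernel `k ≥ -M` with `BilinBoundedBy k W Z X` and
  `|A z - B w| ≤ R`, `[B w < A z] · k` is `BilinBoundedBy` with bound
  `(3(1 + log R) + 3) X + 2 ∑_{|A z - B w| ≤ 3/R} M w z` — exactly the shape of Lemma 7.10
  (`(log x) sup |smoothed sums| + x^{ν/10} · #shell`), the lattice-point count being left to the user.

Def-free; every statement is about the tree's predicate
`Literature.NumberTheory.Sieve.FriedlanderIwaniecPrimes.BilinBoundedBy`. Nothing here proves anything about the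
Parity summit; these are helpers for the Type-II region stub of one leaf.
-/

noncomputable section

open Real Complex MeasureTheory Set Finset
open scoped FourierTransform
open Literature.NumberTheory.Sieve.FriedlanderIwaniecPrimes

namespace Summit.Parity.GeneralizedHardyLittlewood.FordMaynardSieveConst01651SieveConst01651

variable {ι κ : Type*}

/-! ### Twisting a kernel by a trapezoid of `A z - B w` -/

/-- **Smoothed conditions separate for free.** If every bilinear form in `K` over `W × Z` with `1`-bounded
coefficients is `≤ X`, then so is — up to the factor `∫ ‖𝓕(trapz L δ)‖` — every bilinear form in the kernel
twisted by the trapezoid `trapz L δ (c (A z - B w) + d)` (`δ > 0`, `L ≥ 0`; no hypothesis on `A`, `B`, `c`, `d`):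
by Fourier inversion the trapezoid is an absolutely convergent superposition of products of a unimodular function
of `z` and one of `w`. (The mechanism of Ford–Maynard's Lemma 7.10 with the Mellin pair `f_δ`, `F_δ` replaced by
the tree's trapezoid and its Fourier transform.) [cite: FordMaynard2024PrimeSieves, Lemma 7.10 (proof, `S₁`)] -/
theorem bilin_trapz_twist {K : ι → κ → ℂ} {W : Finset ι} {Z : Finset κ} {X : ℝ}
    (h : BilinBoundedBy K W Z X) {L δ : ℝ} (hδ : 0 < δ) (hL : 0 ≤ L) (A : κ → ℝ) (B : ι → ℝ) (c d : ℝ) :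
    BilinBoundedBy (fun w z => trapzC L δ (c * (A z - B w) + d) * K w z) W Z
      ((∫ ξ : ℝ, ‖𝓕 (trapzC L δ) ξ‖) * X) := by
  intro a b ha hb
  have hX0 : 0 ≤ X := h.nonneg
  set H : ℝ → ℂ := 𝓕 (trapzC L δ) with hH
  have hHint : Integrable H := integrable_fourier_trapzC hδ hL
  -- the twisted coefficients
  set aξ : ℝ → ι → ℂ := fun ξ w => a w * cexp (2 * π * I * (ξ : ℂ) * ((-(c * B w) + d : ℝ) : ℂ))
    with haξ
  set bξ : ℝ → κ → ℂ := fun ξ z => b z * cexp (2 * π * I * (ξ : ℂ) * ((c * A z : ℝ) : ℂ)) with hbξ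
  have hphase : ∀ t ξ : ℝ, ‖cexp (2 * π * I * (ξ : ℂ) * (t : ℂ))‖ = 1 := by
    intro t ξ
    rw [show (2 * π * I * (ξ : ℂ) * (t : ℂ)) = ((2 * π * ξ * t : ℝ) : ℂ) * I by push_cast; ring,
      Complex.norm_exp_ofReal_mul_I]
  have haξ1 : ∀ ξ w, ‖aξ ξ w‖ ≤ 1 := fun ξ w => by
    rw [haξ]; simp only; rw [norm_mul, hphase, mul_one]; exact ha w
  have hbξ1 : ∀ ξ z, ‖bξ ξ z‖ ≤ 1 := fun ξ z => by
    rw [hbξ]; simp only; rw [norm_mul, hphase, mul_one]; exact hb z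
  -- the bilinear form at frequency `ξ`
  set S : ℝ → ℂ := fun ξ => ∑ w ∈ W, ∑ z ∈ Z, aξ ξ w * bξ ξ z * K w z with hS
  have hSbound : ∀ ξ, ‖S ξ‖ ≤ X := fun ξ => h _ _ (haξ1 ξ) (hbξ1 ξ)
  -- each summand as an integral
  have hterm : ∀ w ∈ W, ∀ z ∈ Z,
      a w * b z * (trapzC L δ (c * (A z - B w) + d) * K w z) =
        ∫ ξ : ℝ, aξ ξ w * bξ ξ z * K w z * H ξ := by
    intro w _ z _
    rw [← integral_cexp_mul_fourier_trapzC hδ hL (c * (A z - B w) + d), ← integral_mul_const,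
      ← integral_const_mul]
    refine integral_congr_ae (Filter.Eventually.of_forall fun ξ => ?_)
    rw [haξ, hbξ, hH]
    simp only
    have : cexp (2 * π * I * (ξ : ℂ) * ((c * (A z - B w) + d : ℝ) : ℂ)) =
        cexp (2 * π * I * (ξ : ℂ) * ((-(c * B w) + d : ℝ) : ℂ)) *
          cexp (2 * π * I * (ξ : ℂ) * ((c * A z : ℝ) : ℂ)) := by
      rw [← Complex.exp_add]; congr 1; push_cast; ring
    rw [this]; ring
  have hint : ∀ w ∈ W, ∀ z ∈ Z, Integrable fun ξ : ℝ => aξ ξ w * bξ ξ z * K w z * H ξ := by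
    intro w _ z _
    refine hHint.bdd_mul (c := ‖K w z‖) ?_ (Filter.Eventually.of_forall fun ξ => ?_)
    · rw [haξ, hbξ]
      exact Continuous.aestronglyMeasurable (by fun_prop)
    · rw [norm_mul, norm_mul]
      calc ‖aξ ξ w‖ * ‖bξ ξ z‖ * ‖K w z‖ ≤ 1 * 1 * ‖K w z‖ :=
            mul_le_mul_of_nonneg_right (mul_le_mul (haξ1 ξ w) (hbξ1 ξ z) (norm_nonneg _) zero_le_one)
              (norm_nonneg _)
        _ = ‖K w z‖ := by ring
  -- exchange sum and integral
  have hsum : ∑ w ∈ W, ∑ z ∈ Z, a w * b z * (trapzC L δ (c * (A z - B w) + d) * K w z) =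
      ∫ ξ : ℝ, S ξ * H ξ := by
    calc ∑ w ∈ W, ∑ z ∈ Z, a w * b z * (trapzC L δ (c * (A z - B w) + d) * K w z)
        = ∑ w ∈ W, ∑ z ∈ Z, ∫ ξ : ℝ, aξ ξ w * bξ ξ z * K w z * H ξ :=
          sum_congr rfl fun w hw => sum_congr rfl fun z hz => hterm w hw z hz
      _ = ∑ w ∈ W, ∫ ξ : ℝ, ∑ z ∈ Z, aξ ξ w * bξ ξ z * K w z * H ξ :=
          sum_congr rfl fun w hw => (integral_finsetSum Z fun z hz => hint w hw z hz).symm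
      _ = ∫ ξ : ℝ, ∑ w ∈ W, ∑ z ∈ Z, aξ ξ w * bξ ξ z * K w z * H ξ :=
          (integral_finsetSum W fun w hw => integrable_finsetSum Z fun z hz => hint w hw z hz).symm
      _ = ∫ ξ : ℝ, S ξ * H ξ := by
          refine integral_congr_ae (Filter.Eventually.of_forall fun ξ => ?_)
          simp only [hS, sum_mul]
  rw [hsum]
  -- bound the integral
  have hle : ∀ ξ, ‖S ξ * H ξ‖ ≤ X * ‖H ξ‖ := fun ξ => by
    rw [norm_mul]; exact mul_le_mul_of_nonneg_right (hSbound ξ) (norm_nonneg _)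
  calc ‖∫ ξ : ℝ, S ξ * H ξ‖ ≤ ∫ ξ : ℝ, X * ‖H ξ‖ :=
        norm_integral_le_of_norm_le (hHint.norm.const_mul X) (Filter.Eventually.of_forall hle)
    _ = X * ∫ ξ : ℝ, ‖H ξ‖ := integral_const_mul _ _
    _ = (∫ ξ : ℝ, ‖H ξ‖) * X := by ring

/-- The case `H = trapz R² 1` of `bilin_trapz_twist`, with the tree's `∫ ‖𝓕H‖ ≤ 3(1 + log R)` (`R ≥ 1`):
twisting by `H(R (A z - B w) - 1)` costs the factor `3(1 + log R)` — still with NO hypothesis relating `A` and `B`.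
[cite: FordMaynard2024PrimeSieves, Lemma 7.10 (proof, `S₁`)] -/
theorem bilin_trapz_twist_sq {K : ι → κ → ℂ} {W : Finset ι} {Z : Finset κ} {X : ℝ}
    (h : BilinBoundedBy K W Z X) (A : κ → ℝ) (B : ι → ℝ) {R : ℝ} (hR : 1 ≤ R) :
    BilinBoundedBy (fun w z => trapzC (R ^ 2) 1 (R * (A z - B w) - 1) * K w z) W Z
      (3 * (1 + Real.log R) * X) := by
  have h1 := bilin_trapz_twist h one_pos (by positivity : (0 : ℝ) ≤ R ^ 2) A B R (-1)
  have h2 : (∫ ξ : ℝ, ‖𝓕 (trapzC (R ^ 2) 1) ξ‖) * X ≤ 3 * (1 + Real.log R) * X :=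
    mul_le_mul_of_nonneg_right (integral_norm_fourier_trapz_sq_le hR) h.nonneg
  refine (h1.mono h2).congr fun w _ z _ => ?_
  simp only [sub_eq_add_neg]

/-! ### The threshold indicator without a gap: smoothed part + shell -/

/-- Pointwise: the indicator `[B < A]` and the trapezoid `H(R(A - B) - 1)` AGREE off the shell `|A - B| < 1/R`
(given `|A - B| ≤ R`), and differ by at most `1` on it. [cite: FordMaynard2024PrimeSieves, Lemma 7.10 (proof,
`𝟙_{x<1} = f_δ(x) + O(g_δ(x))`)] -/
theorem norm_indicator_sub_trapzC_le {R A B : ℝ} (hR : 1 ≤ R) (hsize : |A - B| ≤ R) :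
    ‖(if B < A then (1 : ℂ) else 0) - trapzC (R ^ 2) 1 (R * (A - B) - 1)‖ ≤
      if |A - B| < 1 / R then 1 else 0 := by
  by_cases hshell : |A - B| < 1 / R
  · -- on the shell both numbers lie in `[0, 1]`
    rw [if_pos hshell]
    have h0 := trapz_nonneg (R ^ 2) 1 (R * (A - B) - 1)
    have h1 := trapz_le_one (R ^ 2) 1 (R * (A - B) - 1)
    have key : ∀ e : ℝ, 0 ≤ e → e ≤ 1 →
        ‖((e : ℝ) : ℂ) - trapzC (R ^ 2) 1 (R * (A - B) - 1)‖ ≤ 1 := by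
      intro e he0 he1
      show ‖((e : ℝ) : ℂ) - ((trapz (R ^ 2) 1 (R * (A - B) - 1) : ℝ) : ℂ)‖ ≤ 1
      rw [← Complex.ofReal_sub, Complex.norm_real, Real.norm_eq_abs, abs_le]
      constructor <;> linarith
    by_cases hlt : B < A
    · rw [if_pos hlt]; simpa using key 1 zero_le_one le_rfl
    · rw [if_neg hlt]; simpa using key 0 le_rfl zero_le_one
  · -- off the shell the tree's identity `[B < A] = H(R(A - B) - 1)` applies
    rw [if_neg hshell]
    have hgap : 1 / R ≤ |A - B| := le_of_not_gt hshell
    have hid := indicator_lt_eq_trapz hR hgap hsize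
    have : (if B < A then (1 : ℂ) else 0) = trapzC (R ^ 2) 1 (R * (A - B) - 1) := by
      show _ = ((trapz (R ^ 2) 1 (R * (A - B) - 1) : ℝ) : ℂ)
      rw [← hid]; split_ifs <;> simp
    rw [this, sub_self, norm_zero]

/-- **Ford–Maynard Lemma 7.10 for bilinear forms (threshold separation without a gap).** If every bilinear form
in `K` over `W × Z` with `1`-bounded coefficients is `≤ X`, and `|A z - B w| ≤ R` on `W × Z` (`R ≥ 1`), then every
bilinear form in `[B w < A z] · K` with `1`-bounded coefficients is at most
`3(1 + log R) · X + ∑_{w ∈ W} ∑_{z ∈ Z, |A z - B w| < 1/R} ‖K w z‖`: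
the smoothed indicator separates (cost `3(1 + log R)`), the rest lives on the shell of width `1/R` and is
bounded trivially. With a gap `|A z - B w| ≥ 1/R` the shell is empty and this is the tree's
`BilinBoundedBy.threshold`. [cite: FordMaynard2024PrimeSieves, Lemma 7.10] -/
theorem bilin_threshold_shell {K : ι → κ → ℂ} {W : Finset ι} {Z : Finset κ} {X : ℝ}
    (h : BilinBoundedBy K W Z X) {A : κ → ℝ} {B : ι → ℝ} {R : ℝ} (hR : 1 ≤ R)
    (hsize : ∀ w ∈ W, ∀ z ∈ Z, |A z - B w| ≤ R) :
    BilinBoundedBy (fun w z => (if B w < A z then (1 : ℂ) else 0) * K w z) W Z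
      (3 * (1 + Real.log R) * X +
        ∑ w ∈ W, ∑ z ∈ Z, if |A z - B w| < 1 / R then ‖K w z‖ else 0) := by
  have h1 := bilin_trapz_twist_sq h A B hR
  have h2 : BilinBoundedBy
      (fun w z => ((if B w < A z then (1 : ℂ) else 0) - trapzC (R ^ 2) 1 (R * (A z - B w) - 1)) * K w z)
      W Z (∑ w ∈ W, ∑ z ∈ Z, if |A z - B w| < 1 / R then ‖K w z‖ else 0) := by
    refine BilinBoundedBy.of_norm_le fun w hw z hz => ?_
    rw [norm_mul]
    have := norm_indicator_sub_trapzC_le (A := A z) (B := B w) hR (hsize w hw z hz)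
    calc ‖(if B w < A z then (1 : ℂ) else 0) - trapzC (R ^ 2) 1 (R * (A z - B w) - 1)‖ * ‖K w z‖
        ≤ (if |A z - B w| < 1 / R then 1 else 0) * ‖K w z‖ :=
          mul_le_mul_of_nonneg_right this (norm_nonneg _)
      _ = if |A z - B w| < 1 / R then ‖K w z‖ else 0 := by split_ifs <;> simp
  refine (h1.add h2).congr fun w _ z _ => ?_
  ring

/-- The non-strict variant: the same bound plus `X` for `[B w ≤ A z] · K` (as `[B ≤ A] = 1 - [A < B]` and the
shell is symmetric). "The same bound holds if the strict inequality is replaced by the nonstrict one."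
[cite: FordMaynard2024PrimeSieves, Lemma 7.10 (last sentence)] -/
theorem bilin_threshold_shell_le {K : ι → κ → ℂ} {W : Finset ι} {Z : Finset κ} {X : ℝ}
    (h : BilinBoundedBy K W Z X) {A : κ → ℝ} {B : ι → ℝ} {R : ℝ} (hR : 1 ≤ R)
    (hsize : ∀ w ∈ W, ∀ z ∈ Z, |A z - B w| ≤ R) :
    BilinBoundedBy (fun w z => (if B w ≤ A z then (1 : ℂ) else 0) * K w z) W Z
      (X + (3 * (1 + Real.log R) * X +
        ∑ w ∈ W, ∑ z ∈ Z, if |A z - B w| < 1 / R then ‖K w z‖ else 0)) := by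
  -- `[A z < B w] = [B' w < A' z]` with `A' = -A`, `B' = -B`; same shell
  have hsize' : ∀ w ∈ W, ∀ z ∈ Z, |(-A z) - (-B w)| ≤ R := fun w hw z hz => by
    rw [show (-A z) - (-B w) = -(A z - B w) by ring, abs_neg]; exact hsize w hw z hz
  have h1 := bilin_threshold_shell h (A := fun z => -A z) (B := fun w => -B w) hR hsize'
  have h2 := (h1.const_mul (-1)).mono (le_of_eq (by rw [norm_neg, norm_one, one_mul]))
  have h3 := h.add h2
  have hshell : ∀ w z, (if |(-A z) - (-B w)| < 1 / R then ‖K w z‖ else 0) =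
      if |A z - B w| < 1 / R then ‖K w z‖ else 0 := fun w z => by
    rw [show (-A z) - (-B w) = -(A z - B w) by ring, abs_neg]
  simp only [hshell] at h3
  refine h3.congr fun w _ z _ => ?_
  by_cases hle : B w ≤ A z
  · have : ¬ (-B w < -A z) := not_lt.mpr (by linarith)
    simp [hle, this]
  · have : -B w < -A z := by linarith [not_le.mp hle]
    simp [hle, this]

/-! ### The shell mass of a kernel bounded below -/

/-- `∫ ‖𝓕(trapz 2 1)‖ ≤ 3` (crudely, from the tree's majorant: `2 (3/(2π) + log(7/2)/π + log 2/(2π)) < 2.2`).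
[folklore] -/
theorem integral_norm_fourier_trapz_two_one_le :
    ∫ ξ : ℝ, ‖𝓕 (trapzC 2 1) ξ‖ ≤ 3 := by
  have h1 := integral_norm_fourier_trapzC_le (L := 2) (δ := 1) one_pos (by norm_num)
  have h2 := integral_fourierMajorant_le (L := 2) (δ := 1) one_pos (by norm_num) (by norm_num)
  have hπ := Real.pi_gt_three
  have hlog2 := Real.log_two_lt_d9
  have hlog : Real.log (1 + 2 + 1 / 2) ≤ 2 * Real.log 2 := by
    calc Real.log (1 + 2 + 1 / 2) ≤ Real.log (2 ^ 2) := Real.log_le_log (by norm_num) (by norm_num)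
      _ = 2 * Real.log 2 := by rw [Real.log_pow]; push_cast; ring
  have hlog2' : Real.log (2 / 1) = Real.log 2 := by norm_num
  rw [hlog2'] at h2
  have hA : 3 / (2 * π) ≤ 1 / 2 := by rw [div_le_iff₀ (by positivity)]; linarith
  have hB : Real.log (1 + 2 + 1 / 2) / π ≤ 2 * Real.log 2 / 3 :=
    div_le_div₀ (by positivity) hlog (by norm_num) hπ.le
  have hC : Real.log 2 / (2 * π) ≤ Real.log 2 / 6 :=
    div_le_div_of_nonneg_left (by positivity) (by norm_num) (by linarith)
  linarith

/-- **Shell mass under a lower bound (Ford–Maynard's `S₂ ≤ S₃ + 2S₄`).** Let `k` be a REAL kernel with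
`-M w z ≤ k w z`, `0 ≤ M w z` on `W × Z`, such that every bilinear form in `k` with `1`-bounded coefficients is
`≤ X`. Then for `R > 0` the mass of `|k|` on the shell `|A z - B w| ≤ 1/R` is at most
`3 X + 2 ∑_{w ∈ W} ∑_{z ∈ Z, |A z - B w| ≤ 3/R} M w z`: write `|k| ≤ k + 2M`, majorise the shell indicator by
the trapezoid `trapz 2 1 (R(A z - B w) + 1)` (equal to `1` on the shell, supported on `|A z - B w| ≤ 3/R`), and
separate the `k`-part with `bilin_trapz_twist` (`∫ ‖𝓕(trapz 2 1)‖ ≤ 3`).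
[cite: FordMaynard2024PrimeSieves, Lemma 7.10 (proof, `S₂`, `S₃`, `S₄`)] -/
theorem bilin_shell_abs_sum_le {k M : ι → κ → ℝ} {W : Finset ι} {Z : Finset κ} {X : ℝ}
    (h : BilinBoundedBy (fun w z => (k w z : ℂ)) W Z X)
    (hM0 : ∀ w ∈ W, ∀ z ∈ Z, 0 ≤ M w z) (hkM : ∀ w ∈ W, ∀ z ∈ Z, -M w z ≤ k w z)
    (A : κ → ℝ) (B : ι → ℝ) {R : ℝ} (hR : 0 < R) :
    ∑ w ∈ W, ∑ z ∈ Z, (if |A z - B w| ≤ 1 / R then |k w z| else 0) ≤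
      3 * X + 2 * ∑ w ∈ W, ∑ z ∈ Z, if |A z - B w| ≤ 3 / R then M w z else 0 := by
  -- the majorising trapezoid
  set T : ι → κ → ℝ := fun w z => trapz 2 1 (R * (A z - B w) + 1) with hT
  have hT0 : ∀ w z, 0 ≤ T w z := fun w z => trapz_nonneg _ _ _
  have hT1 : ∀ w z, T w z ≤ 1 := fun w z => trapz_le_one _ _ _
  have hTshell : ∀ w z, |A z - B w| ≤ 1 / R → T w z = 1 := by
    intro w z hwz
    rw [hT]
    simp only
    refine trapz_of_mem_mid one_pos ⟨?_, ?_⟩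
    · have : -(1 / R) ≤ A z - B w := (abs_le.mp hwz).1
      have : -1 ≤ R * (A z - B w) := by
        have := mul_le_mul_of_nonneg_left this hR.le
        rwa [mul_neg, mul_one_div_cancel hR.ne'] at this
      linarith
    · have : A z - B w ≤ 1 / R := (abs_le.mp hwz).2
      have : R * (A z - B w) ≤ 1 := by
        have := mul_le_mul_of_nonneg_left this hR.le
        rwa [mul_one_div_cancel hR.ne'] at this
      linarith
  have hTsupp : ∀ w z, T w z ≠ 0 → |A z - B w| ≤ 3 / R := by
    intro w z hne
    by_contra hfar
    apply hne
    rw [hT]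
    simp only
    refine trapz_eq_zero_of_not_mem one_pos fun hmem => hfar ?_
    obtain ⟨hlo, hhi⟩ := hmem
    rw [abs_le]
    constructor
    · rw [show -(3 / R) = (-3) / R by ring, div_le_iff₀ hR]; linarith
    · rw [le_div_iff₀ hR]; linarith
  -- pointwise majorisation
  have hpt : ∀ w ∈ W, ∀ z ∈ Z,
      (if |A z - B w| ≤ 1 / R then |k w z| else 0) ≤ T w z * k w z + 2 * (T w z * M w z) := by
    intro w hw z hz
    have hkM2 : 0 ≤ k w z + 2 * M w z := by linarith [hM0 w hw z hz, hkM w hw z hz]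
    split_ifs with hwz
    · rw [hTshell w z hwz, one_mul, one_mul]
      exact abs_le_self_add_two_mul (hM0 w hw z hz) (hkM w hw z hz)
    · have := mul_nonneg (hT0 w z) hkM2
      linarith
  have hptM : ∀ w ∈ W, ∀ z ∈ Z, T w z * M w z ≤ if |A z - B w| ≤ 3 / R then M w z else 0 := by
    intro w hw z hz
    split_ifs with hwz
    · calc T w z * M w z ≤ 1 * M w z := mul_le_mul_of_nonneg_right (hT1 w z) (hM0 w hw z hz)
        _ = M w z := one_mul _
    · have : T w z = 0 := by
        by_contra hne; exact hwz (hTsupp w z hne)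
      rw [this, zero_mul]
  -- the separated `k`-part
  have hsep := bilin_trapz_twist h one_pos (by norm_num : (0 : ℝ) ≤ 2) A B R 1
  have hsepX : ‖∑ w ∈ W, ∑ z ∈ Z, (1 : ℂ) * 1 * (trapzC 2 1 (R * (A z - B w) + 1) * (k w z : ℂ))‖ ≤
      3 * X := by
    refine (hsep (fun _ => 1) (fun _ => 1) (fun _ => by simp) (fun _ => by simp)).trans ?_
    exact mul_le_mul_of_nonneg_right integral_norm_fourier_trapz_two_one_le h.nonneg
  have hreal : ∑ w ∈ W, ∑ z ∈ Z, T w z * k w z ≤ 3 * X := by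
    have hcast : (∑ w ∈ W, ∑ z ∈ Z, (1 : ℂ) * 1 * (trapzC 2 1 (R * (A z - B w) + 1) * (k w z : ℂ))) =
        ((∑ w ∈ W, ∑ z ∈ Z, T w z * k w z : ℝ) : ℂ) := by
      push_cast
      refine sum_congr rfl fun w _ => sum_congr rfl fun z _ => ?_
      simp only [hT, trapzC]
      ring
    rw [hcast, Complex.norm_real, Real.norm_eq_abs] at hsepX
    exact (le_abs_self _).trans hsepX
  -- assemble
  calc ∑ w ∈ W, ∑ z ∈ Z, (if |A z - B w| ≤ 1 / R then |k w z| else 0)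
      ≤ ∑ w ∈ W, ∑ z ∈ Z, (T w z * k w z + 2 * (T w z * M w z)) :=
        sum_le_sum fun w hw => sum_le_sum fun z hz => hpt w hw z hz
    _ = (∑ w ∈ W, ∑ z ∈ Z, T w z * k w z) + 2 * ∑ w ∈ W, ∑ z ∈ Z, T w z * M w z := by
        rw [mul_sum, ← sum_add_distrib]
        refine sum_congr rfl fun w _ => ?_
        rw [mul_sum, ← sum_add_distrib]
    _ ≤ 3 * X + 2 * ∑ w ∈ W, ∑ z ∈ Z, if |A z - B w| ≤ 3 / R then M w z else 0 := by
        have := sum_le_sum fun w hw => sum_le_sum fun z hz => hptM w hw z hz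
        linarith [this]

/-- **Ford–Maynard Lemma 7.10, packaged for a kernel bounded below.** Let `k` be a real kernel with
`-M w z ≤ k w z`, `0 ≤ M w z` and `|A z - B w| ≤ R` on `W × Z` (`R ≥ 1`), every bilinear form in which with
`1`-bounded coefficients is `≤ X`. Then every bilinear form in `[B w < A z] · k` with `1`-bounded coefficients is at
most `(3(1 + log R) + 3) · X + 2 ∑_{w ∈ W} ∑_{z ∈ Z, |A z - B w| ≤ 3/R} M w z` — the printed shape
"`(log x) sup |smoothed sums| + (log x) sup |smoothed sums of |ξ| w_n| + x^{ν/10} · #(shell)`", the lattice-point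
count of the shell being left to the user (in the paper: `τ_j`-many tuples per cofactor, `S₄ ≪ x^{1-ν/10}`).
[cite: FordMaynard2024PrimeSieves, Lemma 7.10] -/
theorem bilin_threshold_of_neg_le {k M : ι → κ → ℝ} {W : Finset ι} {Z : Finset κ} {X : ℝ}
    (h : BilinBoundedBy (fun w z => (k w z : ℂ)) W Z X)
    (hM0 : ∀ w ∈ W, ∀ z ∈ Z, 0 ≤ M w z) (hkM : ∀ w ∈ W, ∀ z ∈ Z, -M w z ≤ k w z)
    {A : κ → ℝ} {B : ι → ℝ} {R : ℝ} (hR : 1 ≤ R) (hsize : ∀ w ∈ W, ∀ z ∈ Z, |A z - B w| ≤ R) :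
    BilinBoundedBy (fun w z => (if B w < A z then (1 : ℂ) else 0) * (k w z : ℂ)) W Z
      ((3 * (1 + Real.log R) + 3) * X +
        2 * ∑ w ∈ W, ∑ z ∈ Z, if |A z - B w| ≤ 3 / R then M w z else 0) := by
  have hR0 : 0 < R := by linarith
  have h1 := bilin_threshold_shell h hR hsize
  have h2 := bilin_shell_abs_sum_le h hM0 hkM A B hR0
  refine h1.mono ?_
  have h3 : ∑ w ∈ W, ∑ z ∈ Z, (if |A z - B w| < 1 / R then ‖((k w z : ℝ) : ℂ)‖ else 0) ≤
      ∑ w ∈ W, ∑ z ∈ Z, (if |A z - B w| ≤ 1 / R then |k w z| else 0) := by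
    refine sum_le_sum fun w _ => sum_le_sum fun z _ => ?_
    rw [Complex.norm_real, Real.norm_eq_abs]
    split_ifs with h₁ h₂
    · exact le_rfl
    · exact absurd h₁.le h₂
    · exact abs_nonneg _
    · exact le_rfl
  linarith

end Summit.Parity.GeneralizedHardyLittlewood.FordMaynardSieveConst01651SieveConst01651
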